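import Literature.MathematicalPhysics.QuantumLattice.XYOrderGDProofs
import Literature.MathematicalPhysics.QuantumLattice.XYOrderInfraredProofs
import Literature.MathematicalPhysics.QuantumLattice.TraceReflectionPositivityProofs
import Literature.MathematicalPhysics.QuantumLattice.DuhamelTwoPointProofs
import HarnessLib

/-!
# Gaussian domination for a field on the bonds crossing the reflection plane — one Schwarz step (DLS 1978, Thm. 4.2)

Topic `Literature/MathematicalPhysics/QuantumLattice`; proofs-only companion of `KroneckerTraceSchwarz.lean`
(the Dyson–Lieb–Simon trace Schwarz inequality `Matrix.trace_exp_kroneckerSum_le`, [DLS1978] Lemma 4.1)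
and of `XYOrderGDProofs.lean` (`Matrix.kls_groundEnergy_reflection`, the ground-state form
[KLS1988JSP] (20)–(25)). No definition of a model, no named fact: everything is proved, in the
ABSTRACT Kronecker setting of those files.

## Source and statement

F. J. Dyson, E. H. Lieb, B. Simon, *Phase transitions in quantum spin systems with isotropic and
nonisotropic interactions*, J. Stat. Phys. 18 (1978) 335–383 [DLS1978], §4 "Gaussian domination — the
quantum case" (read in the held reprint, Lieb's *Selecta*, pp. 352–355): the Hamiltonians covered are
those of the form **(41b)** `H = Σ_α [A_α + ½ Σ_m (S_α - S_{α+δ_m})²]` — on-site terms plus COMPLETED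
SQUARES OF DIFFERENCES across bonds — "in which all the matrices are real" (**Theorem 4.2**, Gaussian
domination: `Tr exp[-βH + σ(Σ∂ᵢhᵢ)] / Tr exp(-βH) ≤ exp(‖h‖²/2β)`, i.e. after completing the square
`Z(h) := Tr exp(-Σ A - ½ Σ_bonds (S_α - S_{α+δ} - h_bond)²) ≤ Z(0)`); the remark on p. 355 records
why reality is needed (the ferromagnet: "`Tr(σ·σ)³ < 0`"). The proof of Thm. 4.2 reflects through
planes; for the bonds CUT by a plane the field is absorbed half into each side
(`S_l - S_r - h = (S_l - h/2) - (S_r + h/2)`), and Lemma 4.1 compares `Z` with the two reflected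
configurations. THIS FILE proves exactly that one-plane step, in the abstract two-factor setting
`ℂ^m ⊗ ℂ^m` (left factor = one half, right factor = the other; `A` real = everything inside a half,
`C_i` real = the operators of the cut bonds), for a field `h` living ONLY on the cut bonds — where
the reflected configurations are both the ZERO-field one, so a single Schwarz inequality already gives
Gaussian domination, with no lattice symmetry and no descent:

* `crossingFieldExponent A C h = A ⊗ 1 + 1 ⊗ A - ½ Σ_i (C_i ⊗ 1 - 1 ⊗ C_i - h_i)²` (the exponent
  `-βH(h)` with the field on the crossing bonds; `β` absorbed);
* `crossingFieldExponent_eq_kroneckerForm` — the DLS splitting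
  `= A_h ⊗ 1 + 1 ⊗ B_h + Σ_i M_i ⊗ N_i`, `M_i = C_i - (h_i/2)`, `N_i = C_i + (h_i/2)`,
  `A_h = A - ½ΣM_i²`, `B_h = A - ½ΣN_i²`, whose two "doubled" configurations
  `A_h ⊗ 1 + 1 ⊗ A_h + ΣM_i ⊗ M_i` and `B_h ⊗ 1 + 1 ⊗ B_h + ΣN_i ⊗ N_i` both EQUAL the zero-field
  exponent (`kroneckerForm_shift_eq_zeroField`: the scalar shifts cancel inside the squares);
* `trace_exp_crossingFieldExponent_le` — **thermal Gaussian domination, one plane**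
  ([DLS1978] Thm. 4.2 core step): for real `A`, `C_i` and every real field `h`,
  `Re Tr exp X(h) ≤ Re Tr exp X(0)`;
* `groundEnergy_crossingField_ge` — **ground-state Gaussian domination, one plane**
  ([KLS1988JSP] (18), (20)–(25), via `Matrix.kls_groundEnergy_reflection`): for real symmetric `A`,
  `C_i`, `E₀(-X(0)) ≤ E₀(-X(h))`;
* `neg_crossingFieldExponent_smul`, `groundEnergy_le_pencil` — the same as the quadratic pencil
  `E₀(H) ≤ E₀(H + t·V_h + ½t²‖h‖²)` for all real `t` (`H = -X(0)`, `V_h = Σ h_i (1 ⊗ C_i - C_i ⊗ 1)`,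
  `Q = ‖h‖² = Σ h_i²`), i.e. EXACTLY the hypothesis `hGD` of the tree's model-free transfer
  `Matrix.groundState_infraredBound` (`XYOrderInfraredProofs.lean`), and
* `groundState_infraredBound_crossingField` — that transfer applied: the ground-state infrared bound
  `(Re ω(V_h²))² ≤ ½‖h‖²·Re ω(V_h(H - E₀)V_h)` across one plane, UNCONDITIONAL for the DLS class.
* `partitionFn_pencil_le`, `duhamel_fieldOp_le` — the THERMAL transfer likewise: the pencil
  `Re Z₁(H - tV + ½t²Q) ≤ Re Z₁(H)` is the hypothesis of `Matrix.gaussianDomination_duhamel_le_holds`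
  ([DLS1978] eq. (44)), whence the Duhamel infrared bound `Re (V_h, V_h) ≤ ‖h‖²` across one plane.

What this types, for the record (cell `hubbard-cq`, row PC, dictionary step S6/B2 of
`pub/hubbard-cq/hubbard-pc-lens-transfer-2/DICTIONARY-transfer2.md`): Gaussian domination is available,
by positivity alone, for a field that SHIFTS A CROSS-PLANE DIFFERENCE `C ⊗ 1 - 1 ⊗ C` of REAL operators
inside a completed square of the Hamiltonian — the class (41b). The `t²`-coefficient ("`Q`" of the KLS
transfer) is then the number of shifted squares, `½ Σ_i h_i²·1`. An operator that is not such a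
difference-in-a-square (e.g. a bond pair field of a lattice fermion model, whose square is not a term of
`H` and which is not a one-body cross-plane hopping term) is outside the class; nothing here says
Gaussian domination fails for it — only that this mechanism does not supply it.

NOT here: the multi-plane descent over a torus (model files `HeisenbergOrderDLSGaussianDomination`,
`XYOrderGDProofs`, `HalfFillingGaussianDomination`, `XYZGroundStateOrderGD` do it model by model), the
infrared bound itself (`DuhamelTwoPoint.gaussianDomination_duhamel_le_holds`, `Matrix.groundState_infraredBound`),
antilinear / twisted reflections (`LiebFluxPhaseDLS`).
-/

noncomputable section

open scoped Matrix.Norms.L2Operator ComplexOrder Kronecker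
open Finset NormedSpace Matrix

namespace Literature.MathematicalPhysics.QuantumLattice

namespace CrossingFieldGD

variable {m ι : Type} [Fintype m] [DecidableEq m] [Fintype ι]

/-! ### The objects -/

/-- The exponent `-βH(h) = A ⊗ 1 + 1 ⊗ A - ½ Σ_i (C_i ⊗ 1 - 1 ⊗ C_i - h_i·1)²`: a Hamiltonian of the
DLS class (41b) seen across ONE reflection plane — `A` collects everything inside one half (and its
mirror image inside the other), the `C_i` are the operators of the bonds cut by the plane, and the real
field `h_i` shifts the `i`-th crossing difference. [cite: DLS1978, §4 eq. (41b) and Thm. 4.2] -/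
def crossingFieldExponent (A : Matrix m m ℂ) (C : ι → Matrix m m ℂ) (h : ι → ℝ) :
    Matrix (m × m) (m × m) ℂ :=
  A ⊗ₖ (1 : Matrix m m ℂ) + (1 : Matrix m m ℂ) ⊗ₖ A -
    (1 / 2 : ℂ) • ∑ i, ((C i) ⊗ₖ (1 : Matrix m m ℂ) - (1 : Matrix m m ℂ) ⊗ₖ (C i) -
      ((h i : ℝ) : ℂ) • (1 : Matrix (m × m) (m × m) ℂ)) ^ 2

/-- The DLS Kronecker form `A ⊗ 1 + 1 ⊗ B + Σ_i M_i ⊗ N_i` of `KroneckerTraceSchwarz.lean`.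
[cite: DLS1978, Lemma 4.1 eq. (45)] -/
def kroneckerForm (A B : Matrix m m ℂ) (M N : ι → Matrix m m ℂ) : Matrix (m × m) (m × m) ℂ :=
  A ⊗ₖ (1 : Matrix m m ℂ) + (1 : Matrix m m ℂ) ⊗ₖ B + ∑ i, M i ⊗ₖ N i

/-- The half-shifted crossing operators `M_i = C_i - (h_i/2)·1` (left copy), written as a shift by the
real scalar `-h_i/2`. [cite: DLS1978, proof of Thm. 4.2] -/
def shiftL (C : ι → Matrix m m ℂ) (h : ι → ℝ) : ι → Matrix m m ℂ :=
  fun i => C i + ((-(h i / 2) : ℝ) : ℂ) • (1 : Matrix m m ℂ)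

/-- The half-shifted crossing operators `N_i = C_i + (h_i/2)·1` (right copy).
[cite: DLS1978, proof of Thm. 4.2] -/
def shiftR (C : ι → Matrix m m ℂ) (h : ι → ℝ) : ι → Matrix m m ℂ :=
  fun i => C i + ((h i / 2 : ℝ) : ℂ) • (1 : Matrix m m ℂ)

/-- The one-half operator with the completed squares of the crossing operators removed:
`A - ½ Σ_i P_i²`. [cite: DLS1978, proof of Thm. 4.2] -/
def halfOp (A : Matrix m m ℂ) (P : ι → Matrix m m ℂ) : Matrix m m ℂ :=
  A - (1 / 2 : ℂ) • ∑ i, P i ^ 2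

/-! ### Kronecker algebra -/

/-- `(P ⊗ 1 - 1 ⊗ Q)² = P² ⊗ 1 + 1 ⊗ Q² - 2·(P ⊗ Q)` (the two factors commute). [folklore] -/
private theorem sq_kronecker_sub (P Q : Matrix m m ℂ) :
    (P ⊗ₖ (1 : Matrix m m ℂ) - (1 : Matrix m m ℂ) ⊗ₖ Q) ^ 2 =
      (P ^ 2) ⊗ₖ (1 : Matrix m m ℂ) + (1 : Matrix m m ℂ) ⊗ₖ (Q ^ 2) - (2 : ℂ) • (P ⊗ₖ Q) := by
  rw [sq, sq, sq, sub_mul, mul_sub, mul_sub, ← mul_kronecker_mul, ← mul_kronecker_mul,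
    ← mul_kronecker_mul, ← mul_kronecker_mul]
  simp only [Matrix.mul_one, Matrix.one_mul, two_smul]
  abel

omit [Fintype m] in
/-- Absorbing a scalar shift half into each side:
`C ⊗ 1 - 1 ⊗ C - (a + b)·1 = (C - a·1) ⊗ 1 - 1 ⊗ (C + b·1)`. [cite: DLS1978, proof of Thm. 4.2] -/
private theorem kronecker_sub_shift (C : Matrix m m ℂ) (a b : ℂ) :
    C ⊗ₖ (1 : Matrix m m ℂ) - (1 : Matrix m m ℂ) ⊗ₖ C - (a + b) • (1 : Matrix (m × m) (m × m) ℂ) =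
      (C + (-a) • (1 : Matrix m m ℂ)) ⊗ₖ (1 : Matrix m m ℂ) -
        (1 : Matrix m m ℂ) ⊗ₖ (C + b • (1 : Matrix m m ℂ)) := by
  rw [← one_kronecker_one, add_kronecker, kronecker_add, smul_kronecker, kronecker_smul]
  module

/-- **Completing the square in Kronecker form**: for any `A, A'` and families `P, Q`,
`(A - ½ΣP_i²) ⊗ 1 + 1 ⊗ (A' - ½ΣQ_i²) + Σ P_i ⊗ Q_i = A ⊗ 1 + 1 ⊗ A' - ½ Σ (P_i ⊗ 1 - 1 ⊗ Q_i)²`.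
[cite: DLS1978, §4 eq. (41a)–(41b)] -/
theorem kroneckerForm_halfOp (A A' : Matrix m m ℂ) (P Q : ι → Matrix m m ℂ) :
    kroneckerForm (halfOp A P) (halfOp A' Q) P Q =
      A ⊗ₖ (1 : Matrix m m ℂ) + (1 : Matrix m m ℂ) ⊗ₖ A' -
        (1 / 2 : ℂ) • ∑ i, (P i ⊗ₖ (1 : Matrix m m ℂ) - (1 : Matrix m m ℂ) ⊗ₖ Q i) ^ 2 := by
  simp_rw [sq_kronecker_sub]
  rw [Finset.sum_sub_distrib, Finset.sum_add_distrib, ← Finset.smul_sum, kroneckerForm, halfOp, halfOp,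
    sub_kronecker, kronecker_sub, smul_kronecker, kronecker_smul, sum_kronecker, kronecker_sum]
  module

/-- **The DLS splitting of the crossing-field exponent**:
`X(h) = A_h ⊗ 1 + 1 ⊗ B_h + Σ_i M_i ⊗ N_i` with `M_i = C_i - h_i/2`, `N_i = C_i + h_i/2`,
`A_h = A - ½ΣM_i²`, `B_h = A - ½ΣN_i²`. [cite: DLS1978, proof of Thm. 4.2] -/
theorem crossingFieldExponent_eq_kroneckerForm (A : Matrix m m ℂ) (C : ι → Matrix m m ℂ) (h : ι → ℝ) :
    crossingFieldExponent A C h =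
      kroneckerForm (halfOp A (shiftL C h)) (halfOp A (shiftR C h)) (shiftL C h) (shiftR C h) := by
  rw [kroneckerForm_halfOp, crossingFieldExponent]
  congr 2
  refine Finset.sum_congr rfl fun i _ => ?_
  rw [shiftL, shiftR, Complex.ofReal_neg, ← kronecker_sub_shift, ← Complex.ofReal_add, add_halves]

/-- **The reflected ("doubled") configurations are the zero-field one**: for shifted operators
`P_i = C_i + a_i·1` (any real `a_i`), `(A - ½ΣP_i²) ⊗ 1 + 1 ⊗ (A - ½ΣP_i²) + Σ P_i ⊗ P_i = X(0)` —
the shifts cancel inside `P_i ⊗ 1 - 1 ⊗ P_i = C_i ⊗ 1 - 1 ⊗ C_i`. [cite: DLS1978, proof of Thm. 4.2] -/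
theorem kroneckerForm_shift_eq_zeroField (A : Matrix m m ℂ) (C : ι → Matrix m m ℂ) (a : ι → ℝ) :
    kroneckerForm (halfOp A (fun i => C i + ((a i : ℝ) : ℂ) • (1 : Matrix m m ℂ)))
        (halfOp A (fun i => C i + ((a i : ℝ) : ℂ) • (1 : Matrix m m ℂ)))
        (fun i => C i + ((a i : ℝ) : ℂ) • (1 : Matrix m m ℂ))
        (fun i => C i + ((a i : ℝ) : ℂ) • (1 : Matrix m m ℂ)) =
      crossingFieldExponent A C 0 := by
  rw [kroneckerForm_halfOp, crossingFieldExponent]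
  congr 2
  refine Finset.sum_congr rfl fun i _ => ?_
  have h := kronecker_sub_shift (C i) (-((a i : ℝ) : ℂ)) ((a i : ℝ) : ℂ)
  rw [neg_add_cancel, neg_neg] at h
  rw [← h, Pi.zero_apply, Complex.ofReal_zero]

/-! ### Reality bookkeeping (`Xᵀ = Xᴴ`) -/

omit [Fintype m] [DecidableEq m] in
/-- `(1/2)•X` is real when `X` is. [folklore] -/
private theorem transpose_eq_conjTranspose_half_smul {X : Matrix m m ℂ} (hX : Xᵀ = Xᴴ) :
    ((1 / 2 : ℂ) • X)ᵀ = ((1 / 2 : ℂ) • X)ᴴ := by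
  have : (1 / 2 : ℂ) = ((1 / 2 : ℝ) : ℂ) := by push_cast; ring
  rw [this]
  exact transpose_eq_conjTranspose_ofReal_smul hX _

omit [Fintype m] [Fintype ι] in
/-- Shifted real operators are real. [folklore] -/
private theorem transpose_eq_conjTranspose_shift {C : ι → Matrix m m ℂ} (hC : ∀ i, (C i)ᵀ = (C i)ᴴ)
    (a : ι → ℝ) (i : ι) :
    (C i + ((a i : ℝ) : ℂ) • (1 : Matrix m m ℂ))ᵀ = (C i + ((a i : ℝ) : ℂ) • (1 : Matrix m m ℂ))ᴴ :=
  transpose_eq_conjTranspose_add (hC i)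
    (transpose_eq_conjTranspose_ofReal_smul transpose_eq_conjTranspose_one _)

/-- `halfOp A P` is real when `A` and the `P_i` are. [folklore] -/
private theorem transpose_eq_conjTranspose_halfOp {A : Matrix m m ℂ} (hA : Aᵀ = Aᴴ)
    {P : ι → Matrix m m ℂ} (hP : ∀ i, (P i)ᵀ = (P i)ᴴ) :
    (halfOp A P)ᵀ = (halfOp A P)ᴴ := by
  refine transpose_eq_conjTranspose_sub hA (transpose_eq_conjTranspose_half_smul
    (transpose_eq_conjTranspose_sum _ fun i _ => ?_))
  rw [sq]
  exact transpose_eq_conjTranspose_mul (hP i) (hP i)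

omit [Fintype m] [DecidableEq m] in
/-- A real matrix is fixed by entrywise conjugation. [folklore] -/
private theorem map_starRingEnd_eq_self_of_real {X : Matrix m m ℂ} (hX : Xᵀ = Xᴴ) :
    X.map (starRingEnd ℂ) = X := by
  have h := congrArg Matrix.transpose hX
  rw [transpose_transpose, conjTranspose, transpose_map, transpose_transpose] at h
  exact h.symm

/-! ### Thermal Gaussian domination across one plane -/

/-- The zero-field functional is nonnegative: `0 ≤ Re Tr exp X(0)` for real `A`, `C_i` (reflection
positivity with the trivial observable, FILS Thm. 2.1). [cite: FILS1978, Thm. 2.1 and §3 example 3] -/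
theorem trace_exp_crossingFieldExponent_zero_nonneg {A : Matrix m m ℂ} (hA : Aᵀ = Aᴴ)
    {C : ι → Matrix m m ℂ} (hC : ∀ i, (C i)ᵀ = (C i)ᴴ) :
    0 ≤ (exp (crossingFieldExponent A C 0)).trace.re := by
  -- `X(0)` is the doubled configuration of the (real) family `C`, with `A₀ = A - ½ΣC²`
  have h0 := kroneckerForm_shift_eq_zeroField A C 0
  simp only [Pi.zero_apply, Complex.ofReal_zero, zero_smul, add_zero] at h0
  rw [← h0, kroneckerForm]
  have hA0 : (halfOp A C)ᵀ = (halfOp A C)ᴴ := transpose_eq_conjTranspose_halfOp hA hC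
  have h := FrohlichIsraelLiebSimon1978_thm21_matrix_holds m ι (halfOp A C) 1 C
  simp only [map_starRingEnd_eq_self_of_real hA0, fun i => map_starRingEnd_eq_self_of_real (hC i),
    map_starRingEnd_eq_self_of_real (transpose_eq_conjTranspose_one (m := m)),
    one_kronecker_one, Matrix.one_mul] at h
  exact h.1

/-- **Dyson–Lieb–Simon 1978, Theorem 4.2 — the one-plane step (thermal Gaussian domination for a
field on the crossing bonds)**: for REAL `A` and `C_i` and every real field `h` on the cut bonds,
`Re Tr exp(A ⊗ 1 + 1 ⊗ A - ½Σ(C_i ⊗ 1 - 1 ⊗ C_i - h_i)²) ≤ Re Tr exp(A ⊗ 1 + 1 ⊗ A - ½Σ(C_i ⊗ 1 - 1 ⊗ C_i)²)`.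
Proof: the DLS splitting (`crossingFieldExponent_eq_kroneckerForm`), the trace Schwarz inequality
`Matrix.trace_exp_kroneckerSum_le` (Lemma 4.1), and the fact that both reflected configurations are
the zero-field one (`kroneckerForm_shift_eq_zeroField`). [cite: DLS1978, Thm. 4.2 and Lemma 4.1] -/
theorem trace_exp_crossingFieldExponent_le [Nonempty m] {A : Matrix m m ℂ} (hA : Aᵀ = Aᴴ)
    {C : ι → Matrix m m ℂ} (hC : ∀ i, (C i)ᵀ = (C i)ᴴ) (h : ι → ℝ) :
    (exp (crossingFieldExponent A C h)).trace.re ≤ (exp (crossingFieldExponent A C 0)).trace.re := by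
  have hM : ∀ i, (shiftL C h i)ᵀ = (shiftL C h i)ᴴ := fun i => by
    unfold shiftL; exact transpose_eq_conjTranspose_shift hC (fun i => -(h i / 2)) i
  have hN : ∀ i, (shiftR C h i)ᵀ = (shiftR C h i)ᴴ := fun i => by
    unfold shiftR; exact transpose_eq_conjTranspose_shift hC (fun i => h i / 2) i
  have hAL := transpose_eq_conjTranspose_halfOp hA hM
  have hAR := transpose_eq_conjTranspose_halfOp hA hN
  have hS := Matrix.trace_exp_kroneckerSum_le (Nn := shiftR C h) hAL hAR hM hN
  have hL : kroneckerForm (halfOp A (shiftL C h)) (halfOp A (shiftL C h)) (shiftL C h) (shiftL C h) =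
      crossingFieldExponent A C 0 := kroneckerForm_shift_eq_zeroField A C (fun i => -(h i / 2))
  have hR : kroneckerForm (halfOp A (shiftR C h)) (halfOp A (shiftR C h)) (shiftR C h) (shiftR C h) =
      crossingFieldExponent A C 0 := kroneckerForm_shift_eq_zeroField A C (fun i => h i / 2)
  rw [crossingFieldExponent_eq_kroneckerForm, kroneckerForm]
  refine hS.trans ?_
  rw [← kroneckerForm, ← kroneckerForm, hL, hR,
    Real.mul_self_sqrt (trace_exp_crossingFieldExponent_zero_nonneg hA hC)]

/-! ### Ground-state Gaussian domination across one plane -/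

omit [Fintype m] [DecidableEq m] in
/-- Kronecker products of Hermitian matrices are Hermitian. [folklore] -/
private theorem isHermitian_kronecker' {X Y : Matrix m m ℂ} (hX : X.IsHermitian) (hY : Y.IsHermitian) :
    (X ⊗ₖ Y).IsHermitian := by
  rw [IsHermitian, conjTranspose_kronecker, hX.eq, hY.eq]

omit [Fintype m] [DecidableEq m] in
/-- `(-X) ⊗ Y = -(X ⊗ Y)`. [folklore] -/
private theorem neg_kronecker' (X Y : Matrix m m ℂ) : (-X) ⊗ₖ Y = -(X ⊗ₖ Y) := by
  ext ⟨i, k⟩ ⟨j, l⟩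
  simp [kroneckerMap_apply]

omit [Fintype m] [DecidableEq m] in
/-- `X ⊗ (-Y) = -(X ⊗ Y)`. [folklore] -/
private theorem kronecker_neg' (X Y : Matrix m m ℂ) : X ⊗ₖ (-Y) = -(X ⊗ₖ Y) := by
  ext ⟨i, k⟩ ⟨j, l⟩
  simp [kroneckerMap_apply]

omit [Fintype m] [DecidableEq m] in
/-- A real symmetric matrix is Hermitian. [folklore] -/
private theorem isHermitian_of_real_symm {X : Matrix m m ℂ} (hXs : Xᵀ = X) (hXr : Xᵀ = Xᴴ) :
    X.IsHermitian := by
  rw [IsHermitian, ← hXr, hXs]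

omit [Fintype m] [DecidableEq m] in
/-- Finite sums of Hermitian matrices are Hermitian. [folklore] -/
private theorem isHermitian_sum' {n : Type} {X : ι → Matrix n n ℂ} (hX : ∀ i, (X i).IsHermitian) :
    (∑ i, X i).IsHermitian := by
  rw [IsHermitian, conjTranspose_sum]
  exact Finset.sum_congr rfl fun i _ => (hX i).eq

omit [Fintype m] in
/-- The KLS Kronecker operator `A ⊗ 1 + 1 ⊗ B - Σ M_i ⊗ N_i` with Hermitian data is Hermitian. [folklore] -/
private theorem isHermitian_klsForm {A B : Matrix m m ℂ} {M N : ι → Matrix m m ℂ}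
    (hA : A.IsHermitian) (hB : B.IsHermitian) (hM : ∀ i, (M i).IsHermitian)
    (hN : ∀ i, (N i).IsHermitian) :
    (A ⊗ₖ (1 : Matrix m m ℂ) + (1 : Matrix m m ℂ) ⊗ₖ B - ∑ i, M i ⊗ₖ N i).IsHermitian :=
  ((isHermitian_kronecker' hA isHermitian_one).add (isHermitian_kronecker' isHermitian_one hB)).sub
    (isHermitian_sum' fun i => isHermitian_kronecker' (hM i) (hN i))

omit [Fintype m] [Fintype ι] in
/-- A shifted symmetric operator is symmetric. [folklore] -/
private theorem transpose_shift {C : ι → Matrix m m ℂ} (hCs : ∀ i, (C i)ᵀ = C i) (a : ι → ℝ) (i : ι) :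
    (C i + ((a i : ℝ) : ℂ) • (1 : Matrix m m ℂ))ᵀ = C i + ((a i : ℝ) : ℂ) • (1 : Matrix m m ℂ) := by
  rw [transpose_add, transpose_smul, transpose_one, hCs i]

/-- `halfOp A P` is symmetric for symmetric data. [folklore] -/
private theorem halfOp_transpose {A : Matrix m m ℂ} (hAs : Aᵀ = A) {P : ι → Matrix m m ℂ}
    (hPs : ∀ i, (P i)ᵀ = P i) : (halfOp A P)ᵀ = halfOp A P := by
  unfold halfOp
  rw [transpose_sub, transpose_smul, transpose_sum, hAs]
  congr 2
  refine Finset.sum_congr rfl fun i _ => ?_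
  rw [sq, transpose_mul, hPs i]

omit [Fintype m] in
/-- The KLS operator `(-A) ⊗ 1 + 1 ⊗ (-B) - Σ P_i ⊗ Q_i` is minus the Kronecker form. [folklore] -/
private theorem klsForm_eq_neg_kroneckerForm (A B : Matrix m m ℂ) (P Q : ι → Matrix m m ℂ) :
    (-A) ⊗ₖ (1 : Matrix m m ℂ) + (1 : Matrix m m ℂ) ⊗ₖ (-B) - ∑ i, P i ⊗ₖ Q i =
      -kroneckerForm A B P Q := by
  rw [kroneckerForm, neg_kronecker', kronecker_neg']
  abel

/-- **Kennedy–Lieb–Shastry 1988, the ground-state energy form of Gaussian domination — one plane**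
([KLS1988JSP] (18): "`E₀(H) ≤ E₀(H(h))`", proof (20)–(25)): for REAL SYMMETRIC `A` and `C_i` and every
real field `h` on the cut bonds, the ground-state energy of `H(h) = -X(h)` is minimal at `h = 0`:
`E₀(-X(0)) ≤ E₀(-X(h))`. Proof: the DLS splitting and `Matrix.kls_groundEnergy_reflection`
(`(E₀(LL) + E₀(RR))/2 ≤ E₀(LR)`), both reflected configurations being the zero-field one. This is the
sourced ENERGY inequality `E₀(H) ≤ E₀(H + tV + ½t²Q)` (linear term `t·Σ_i h_i (C_i ⊗ 1 - 1 ⊗ C_i)`,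
`Q = Σ_i h_i²·1`) consumed by the model-free transfer `Matrix.groundState_infraredBound`.
[cite: KLS1988JSP, eqs. (18), (20)–(25)] [cite: DLS1978, Thm. 4.2] -/
theorem groundEnergy_crossingField_ge [Nonempty m] {A : Matrix m m ℂ} (hAs : Aᵀ = A) (hAr : Aᵀ = Aᴴ)
    {C : ι → Matrix m m ℂ} (hCs : ∀ i, (C i)ᵀ = C i) (hCr : ∀ i, (C i)ᵀ = (C i)ᴴ) (h : ι → ℝ) :
    (-crossingFieldExponent A C 0).groundEnergy ≤ (-crossingFieldExponent A C h).groundEnergy := by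
  -- reality / symmetry / hermiticity of the shifted families and the half operators
  have hMr : ∀ i, (shiftL C h i)ᵀ = (shiftL C h i)ᴴ := fun i => by
    unfold shiftL; exact transpose_eq_conjTranspose_shift hCr (fun i => -(h i / 2)) i
  have hNr : ∀ i, (shiftR C h i)ᵀ = (shiftR C h i)ᴴ := fun i => by
    unfold shiftR; exact transpose_eq_conjTranspose_shift hCr (fun i => h i / 2) i
  have hMs : ∀ i, (shiftL C h i)ᵀ = shiftL C h i := fun i => by
    unfold shiftL; exact transpose_shift hCs (fun i => -(h i / 2)) i
  have hNs : ∀ i, (shiftR C h i)ᵀ = shiftR C h i := fun i => by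
    unfold shiftR; exact transpose_shift hCs (fun i => h i / 2) i
  have hMh : ∀ i, (shiftL C h i).IsHermitian := fun i => isHermitian_of_real_symm (hMs i) (hMr i)
  have hNh : ∀ i, (shiftR C h i).IsHermitian := fun i => isHermitian_of_real_symm (hNs i) (hNr i)
  have hALs := halfOp_transpose hAs hMs
  have hARs := halfOp_transpose hAs hNs
  have hALh : (halfOp A (shiftL C h)).IsHermitian :=
    isHermitian_of_real_symm hALs (transpose_eq_conjTranspose_halfOp hAr hMr)
  have hARh : (halfOp A (shiftR C h)).IsHermitian :=
    isHermitian_of_real_symm hARs (transpose_eq_conjTranspose_halfOp hAr hNr)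
  -- the KLS energy reflection inequality `(E₀(LL) + E₀(RR))/2 ≤ E₀(LR)`
  have key := Matrix.kls_groundEnergy_reflection (-halfOp A (shiftL C h)) (-halfOp A (shiftR C h))
    (shiftL C h) (shiftR C h) (by rw [transpose_neg, hALs]) (by rw [transpose_neg, hARs]) hMr hNr
    (isHermitian_klsForm hALh.neg hARh.neg hMh hNh) (isHermitian_klsForm hALh.neg hALh.neg hMh hMh)
    (isHermitian_klsForm hARh.neg hARh.neg hNh hNh)
  -- identify the three operators: LR = -X(h), LL = RR = -X(0)
  have hL : kroneckerForm (halfOp A (shiftL C h)) (halfOp A (shiftL C h)) (shiftL C h) (shiftL C h) =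
      crossingFieldExponent A C 0 := kroneckerForm_shift_eq_zeroField A C (fun i => -(h i / 2))
  have hR : kroneckerForm (halfOp A (shiftR C h)) (halfOp A (shiftR C h)) (shiftR C h) (shiftR C h) =
      crossingFieldExponent A C 0 := kroneckerForm_shift_eq_zeroField A C (fun i => h i / 2)
  rw [klsForm_eq_neg_kroneckerForm, klsForm_eq_neg_kroneckerForm, klsForm_eq_neg_kroneckerForm,
    ← crossingFieldExponent_eq_kroneckerForm, hL, hR] at key
  linarith

/-! ### The KLS-consumable form: `E₀(H) ≤ E₀(H + tV + ½t²Q)` and the infrared bound -/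

/-- The field operator `V_h = Σ_i h_i (1 ⊗ C_i - C_i ⊗ 1)` (the cross-plane differences weighted by
the field). [cite: KLS1988JSP, eq. (18)] -/
def fieldOp (C : ι → Matrix m m ℂ) (h : ι → ℝ) : Matrix (m × m) (m × m) ℂ :=
  ∑ i, ((h i : ℝ) : ℂ) • ((1 : Matrix m m ℂ) ⊗ₖ C i - C i ⊗ₖ (1 : Matrix m m ℂ))

/-- `(D - c·1)² = D² - (2c)·D + c²·1`. [folklore] -/
private theorem sq_sub_smul_one {n : Type} [Fintype n] [DecidableEq n] (D : Matrix n n ℂ) (c : ℂ) :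
    (D - c • (1 : Matrix n n ℂ)) ^ 2 = D ^ 2 - (2 * c) • D + (c ^ 2) • (1 : Matrix n n ℂ) := by
  rw [sq, sq, sub_mul, mul_sub, mul_sub, Matrix.mul_smul, Matrix.smul_mul, Matrix.mul_one,
    Matrix.one_mul, Matrix.smul_mul, Matrix.one_mul]
  module

/-- **The sourced Hamiltonian is a quadratic pencil in the field strength**:
`-X(t·h) = -X(0) + t·V_h + ½t²‖h‖²·1`. [cite: KLS1988JSP, eq. (18)] [cite: DLS1978, proof of Thm. 4.1 given Thm. 4.2] -/
theorem neg_crossingFieldExponent_smul (A : Matrix m m ℂ) (C : ι → Matrix m m ℂ) (h : ι → ℝ) (t : ℝ) :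
    -crossingFieldExponent A C (t • h) =
      -crossingFieldExponent A C 0 + (t : ℂ) • fieldOp C h +
        ((t ^ 2 * (∑ i, h i ^ 2) / 2 : ℝ) : ℂ) • (1 : Matrix (m × m) (m × m) ℂ) := by
  simp only [crossingFieldExponent, fieldOp, Pi.smul_apply, Pi.zero_apply, smul_eq_mul,
    Complex.ofReal_zero, zero_smul, sub_zero, sq_sub_smul_one, Finset.sum_add_distrib,
    Finset.sum_sub_distrib, smul_add, smul_sub, Finset.smul_sum, smul_smul, neg_sub]
  push_cast
  rw [Finset.mul_sum, Finset.sum_div, Finset.sum_smul]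
  have e1 : ∀ i, (1 / 2 : ℂ) * (2 * ((t : ℂ) * (h i : ℂ))) = (t : ℂ) * (h i : ℂ) := fun i => by ring
  have e2 : ∀ i, (1 / 2 : ℂ) * ((t : ℂ) * (h i : ℂ)) ^ 2 = (t : ℂ) ^ 2 * (h i : ℂ) ^ 2 / 2 :=
    fun i => by ring
  simp only [e1, e2]
  abel

/-- **Gaussian domination in the form consumed by the KLS transfer** (`Matrix.groundState_infraredBound`):
for the DLS class across one plane, `E₀(H) ≤ E₀(H + t·V_h + ½t²‖h‖²)` for EVERY real `t`, with
`H = -X(0)` and `V_h = Σ h_i (1 ⊗ C_i - C_i ⊗ 1)`. [cite: KLS1988JSP, eq. (18)] [cite: DLS1978, Thm. 4.2] -/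
theorem groundEnergy_le_pencil [Nonempty m] {A : Matrix m m ℂ} (hAs : Aᵀ = A) (hAr : Aᵀ = Aᴴ)
    {C : ι → Matrix m m ℂ} (hCs : ∀ i, (C i)ᵀ = C i) (hCr : ∀ i, (C i)ᵀ = (C i)ᴴ) (h : ι → ℝ)
    (t : ℝ) :
    (-crossingFieldExponent A C 0).groundEnergy ≤
      (-crossingFieldExponent A C 0 + (t : ℂ) • fieldOp C h +
        ((t ^ 2 * (∑ i, h i ^ 2) / 2 : ℝ) : ℂ) • (1 : Matrix (m × m) (m × m) ℂ)).groundEnergy := by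
  rw [← neg_crossingFieldExponent_smul]
  exact groundEnergy_crossingField_ge hAs hAr hCs hCr (t • h)

omit [Fintype m] in
/-- The field operator is Hermitian for Hermitian `C_i`. [folklore] -/
private theorem fieldOp_isHermitian {C : ι → Matrix m m ℂ} (hC : ∀ i, (C i).IsHermitian) (h : ι → ℝ) :
    (fieldOp C h).IsHermitian := by
  unfold fieldOp
  refine isHermitian_sum' fun i => ?_
  rw [IsHermitian, conjTranspose_smul, Complex.star_def, Complex.conj_ofReal,
    ((isHermitian_kronecker' isHermitian_one (hC i)).sub (isHermitian_kronecker' (hC i) isHermitian_one)).eq]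

/-- The zero-field Hamiltonian `-X(0)` is Hermitian for real symmetric data. [folklore] -/
private theorem neg_crossingFieldExponent_zero_isHermitian {A : Matrix m m ℂ} (hAs : Aᵀ = A)
    (hAr : Aᵀ = Aᴴ) {C : ι → Matrix m m ℂ} (hCs : ∀ i, (C i)ᵀ = C i) (hCr : ∀ i, (C i)ᵀ = (C i)ᴴ) :
    (-crossingFieldExponent A C 0).IsHermitian := by
  have hC : ∀ i, (C i).IsHermitian := fun i => isHermitian_of_real_symm (hCs i) (hCr i)
  have hA : A.IsHermitian := isHermitian_of_real_symm hAs hAr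
  have h0 := kroneckerForm_shift_eq_zeroField A C 0
  simp only [Pi.zero_apply, Complex.ofReal_zero, zero_smul, add_zero] at h0
  have hA0s : (halfOp A C)ᵀ = halfOp A C := halfOp_transpose hAs hCs
  have hA0 : (halfOp A C).IsHermitian :=
    isHermitian_of_real_symm hA0s (transpose_eq_conjTranspose_halfOp hAr hCr)
  rw [← h0, ← klsForm_eq_neg_kroneckerForm]
  exact isHermitian_klsForm hA0.neg hA0.neg hC hC

/-- **The ground-state infrared bound across one plane, for the DLS class** (Kennedy–Lieb–Shastry's
`(ω(V²))² ≤ ½Q·ω(V(H - E₀)V)` with `Q = ‖h‖²`, here UNCONDITIONAL because Gaussian domination is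
supplied by `groundEnergy_le_pencil`): for real symmetric `A`, `C_i`, every real `h`, and the tracial
ground-state functional `ω` of `H = -X(0)`,
`(Re ω(V_h²))² ≤ (‖h‖²/2) · Re ω(V_h (H - E₀) V_h)`.
[cite: KLS1988JSP, eqs. (12), (14), (18)–(19)] [cite: DLS1978, Thm. 4.1–4.2] -/
theorem groundState_infraredBound_crossingField [Nonempty m] {A : Matrix m m ℂ} (hAs : Aᵀ = A)
    (hAr : Aᵀ = Aᴴ) {C : ι → Matrix m m ℂ} (hCs : ∀ i, (C i)ᵀ = C i) (hCr : ∀ i, (C i)ᵀ = (C i)ᴴ)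
    (h : ι → ℝ) :
    ((-crossingFieldExponent A C 0).groundStateFunctional (fieldOp C h * fieldOp C h)).re ^ 2 ≤
      (∑ i, h i ^ 2) / 2 *
        ((-crossingFieldExponent A C 0).groundStateFunctional
          (fieldOp C h * (-crossingFieldExponent A C 0 -
            ((-crossingFieldExponent A C 0).groundEnergy : ℂ) • 1) * fieldOp C h)).re :=
  Matrix.groundState_infraredBound (neg_crossingFieldExponent_zero_isHermitian hAs hAr hCs hCr)
    (fieldOp_isHermitian (fun i => isHermitian_of_real_symm (hCs i) (hCr i)) h)
    (groundEnergy_le_pencil hAs hAr hCs hCr h)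

/-! ### The thermal transfer: the Duhamel (infrared) bound across one plane -/

/-- **Thermal Gaussian domination in the pencil form consumed by the Duhamel transfer**
(`Matrix.gaussianDomination_duhamel_le`, [DLS1978] eq. (44)): at `β = 1` (inverse temperature
absorbed in `A`, `C`), with `H = -X(0)`, `V = -V_h` and `Q = ‖h‖²`,
`Re Z₁(H - tV + ½t²Q) ≤ Re Z₁(H)` for every real `t` — because `H - tV + ½t²Q = -X(t·h)`.
[cite: DLS1978, Thm. 4.2 and eq. (44)] -/
theorem partitionFn_pencil_le [Nonempty m] {A : Matrix m m ℂ} (hA : Aᵀ = Aᴴ)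
    {C : ι → Matrix m m ℂ} (hC : ∀ i, (C i)ᵀ = (C i)ᴴ) (h : ι → ℝ) (t : ℝ) :
    (Matrix.partitionFn 1 (-crossingFieldExponent A C 0 - (t : ℂ) • (-fieldOp C h) +
        ((t ^ 2 * (∑ i, h i ^ 2) / 2 : ℝ) : ℂ) • (1 : Matrix (m × m) (m × m) ℂ))).re ≤
      (Matrix.partitionFn 1 (-crossingFieldExponent A C 0)).re := by
  rw [smul_neg, sub_neg_eq_add, ← neg_crossingFieldExponent_smul]
  simp only [Matrix.partitionFn, Matrix.gibbsWeight, Complex.ofReal_one, neg_smul, one_smul, neg_neg]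
  exact trace_exp_crossingFieldExponent_le hA hC (t • h)

/-- **Dyson–Lieb–Simon's infrared bound for the Duhamel two-point function across one plane, for
the DLS class** ([DLS1978] Thm. 4.1 via eq. (44): Gaussian domination ⇒ `(V, V) ≤ Q/β`; here
`β = 1`, `H = -X(0)`, `V = V_h = Σ h_i (1 ⊗ C_i - C_i ⊗ 1)`, `Q = ‖h‖²`): for real symmetric `A`, `C_i`
and every real field `h` on the cut bonds, `Re (V_h, V_h)_{1,H} ≤ Σ_i h_i²` — UNCONDITIONAL, the
Gaussian-domination hypothesis of `Matrix.gaussianDomination_duhamel_le_holds` being supplied by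
`partitionFn_pencil_le`. [cite: DLS1978, Thm. 4.1, Thm. 4.2 and eq. (44)] -/
theorem duhamel_fieldOp_le [Nonempty m] {A : Matrix m m ℂ} (hAs : Aᵀ = A) (hAr : Aᵀ = Aᴴ)
    {C : ι → Matrix m m ℂ} (hCs : ∀ i, (C i)ᵀ = C i) (hCr : ∀ i, (C i)ᵀ = (C i)ᴴ) (h : ι → ℝ) :
    (Matrix.duhamel 1 (-crossingFieldExponent A C 0) (fieldOp C h) (fieldOp C h)).re ≤
      ∑ i, h i ^ 2 := by
  have hH := neg_crossingFieldExponent_zero_isHermitian hAs hAr hCs hCr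
  have hV : (fieldOp C h).IsHermitian :=
    fieldOp_isHermitian (fun i => isHermitian_of_real_symm (hCs i) (hCr i)) h
  have key := Matrix.gaussianDomination_duhamel_le_holds (m × m) 1 one_pos (-crossingFieldExponent A C 0)
    (-fieldOp C h) hH hV.neg (∑ i, h i ^ 2) (fun t => partitionFn_pencil_le hAr hCr h t)
  rw [div_one] at key
  simpa only [Matrix.duhamel, neg_mul, mul_neg, neg_neg] using key

end CrossingFieldGD

end Literature.MathematicalPhysics.QuantumLattice

end
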